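import Mathlib
import Summits.Ventures.PercRepro2.CoinOrTailKDefs
import Summits.Ventures.PercRepro2.CoinOrTailKSums
import Summits.Ventures.PercRepro2.CoinOrTailKOneAlg
import Summits.Ventures.PercRepro2.CoinK2HeadAwareCoinsAlg
import Summits.Ventures.PercRepro2.CoinKSureAD

/-!
# Splitting ONE entry coin into a virtual sure entry (blind cell PercRepro2, night-2 g14;
proofs/NIGHT2-DARC.md §49.7)

The coin `r → a` of probability `ρ` of an entry `r` is replaced by a SURE arc from a virtual
vertex `r'`, reached from `r` with probability `ρ`: the extended cluster law
`ν' W' = ν (W' ∩ U) · cf(W')` (the coin factor `cf` of §48.7, log-supermodular), the extended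
head `A' Y = A (Y ∩ V₀)` (`V₀ = U ∪ {a, w}`), the probability vector with the coin of `r`
made sure, the entry set `insert r' (ent.erase r)` and the coin map sending `r'` to the coin of
`r`.  `ext_sum_one`: summing out the virtual coordinate returns the original weights, for the
`R`-law (`X = {a}`) and the gate (`X = {a, w}`) alike; `extLaw_lsm`, `extHead_*`: the extended
system satisfies the hypotheses of the sure-entry theorem.  Iterated over the entries
(`CoinKSureCoins`) this gives row 2′DARC for ARBITRARY coin probabilities and ANY entry set.
-/

namespace Summit.Ventures.PercRepro2.Coin

open Classical

section OneCoin

variable {V : Type*} {E : Type*} [Fintype V] [DecidableEq V] {R : Type*} [Field R] [LinearOrder R]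
  [IsStrictOrderedRing R]

omit [Fintype V] in
/-- The extended law is log-supermodular on `insert r' U`. -/
lemma extLaw_lsm (U : Finset V) (ν : Finset V → R) (r r' : V) (ρ : R) (hρ0 : 0 ≤ ρ) (hρ1 : ρ ≤ 1)
    (hν0 : ∀ W, 0 ≤ ν W) (hν : ∀ s ⊆ U, ∀ t ⊆ U, ν s * ν t ≤ ν (s ∩ t) * ν (s ∪ t)) :
    ∀ s ⊆ insert r' U, ∀ t ⊆ insert r' U,
      (ν (s ∩ U) * (if r' ∈ s then (if r ∈ s then ρ else 0) else (if r ∈ s then 1 - ρ else 1))) *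
        (ν (t ∩ U) * (if r' ∈ t then (if r ∈ t then ρ else 0) else (if r ∈ t then 1 - ρ else 1))) ≤
      (ν ((s ∩ t) ∩ U) *
          (if r' ∈ s ∩ t then (if r ∈ s ∩ t then ρ else 0) else (if r ∈ s ∩ t then 1 - ρ else 1))) *
        (ν ((s ∪ t) ∩ U) *
          (if r' ∈ s ∪ t then (if r ∈ s ∪ t then ρ else 0) else (if r ∈ s ∪ t then 1 - ρ else 1))) := by
  intro s _ t _
  have h1 := hν (s ∩ U) Finset.inter_subset_right (t ∩ U) Finset.inter_subset_right
  rw [← state_inter, ← state_union] at h1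
  have h2 := coinFactor_mul_le (R := R) r r' hρ0 s t
  calc (ν (s ∩ U) * (if r' ∈ s then (if r ∈ s then ρ else 0) else (if r ∈ s then 1 - ρ else 1))) *
        (ν (t ∩ U) * (if r' ∈ t then (if r ∈ t then ρ else 0) else (if r ∈ t then 1 - ρ else 1)))
      = (ν (s ∩ U) * ν (t ∩ U)) *
          ((if r' ∈ s then (if r ∈ s then ρ else 0) else (if r ∈ s then 1 - ρ else 1)) *
           (if r' ∈ t then (if r ∈ t then ρ else 0) else (if r ∈ t then 1 - ρ else 1))) := by ring
    _ ≤ (ν ((s ∩ t) ∩ U) * ν ((s ∪ t) ∩ U)) *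
          ((if r' ∈ s ∩ t then (if r ∈ s ∩ t then ρ else 0) else (if r ∈ s ∩ t then 1 - ρ else 1)) *
           (if r' ∈ s ∪ t then (if r ∈ s ∪ t then ρ else 0) else (if r ∈ s ∪ t then 1 - ρ else 1))) :=
        mul_le_mul h1 h2
          (mul_nonneg (coinFactor_nonneg r r' hρ0 hρ1 s) (coinFactor_nonneg r r' hρ0 hρ1 t))
          (mul_nonneg (hν0 _) (hν0 _))
    _ = _ := by ring

omit [Fintype V] in
/-- The extended law is nonnegative. -/
lemma extLaw_nonneg (U : Finset V) (ν : Finset V → R) (r r' : V) (ρ : R) (hρ0 : 0 ≤ ρ)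
    (hρ1 : ρ ≤ 1) (hν0 : ∀ W, 0 ≤ ν W) (W : Finset V) :
    0 ≤ ν (W ∩ U) * (if r' ∈ W then (if r ∈ W then ρ else 0) else (if r ∈ W then 1 - ρ else 1)) :=
  mul_nonneg (hν0 _) (coinFactor_nonneg r r' hρ0 hρ1 W)

omit [Fintype V] [IsStrictOrderedRing R] in
/-- The extended head is log-supermodular. -/
lemma extHead_lsm (A : Finset V → R) (V₀ : Finset V)
    (hA : ∀ s t : Finset V, A s * A t ≤ A (s ∩ t) * A (s ∪ t)) :
    ∀ s t : Finset V, A (s ∩ V₀) * A (t ∩ V₀) ≤ A ((s ∩ t) ∩ V₀) * A ((s ∪ t) ∩ V₀) := by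
  intro s t
  have := hA (s ∩ V₀) (t ∩ V₀)
  rw [← state_inter, ← state_union] at this
  exact this

omit [Fintype V] [Field R] [IsStrictOrderedRing R] in
/-- The extended head is decreasing. -/
lemma extHead_mono (A : Finset V → R) (V₀ : Finset V)
    (hmono : ∀ s t : Finset V, s ⊆ t → A t ≤ A s) :
    ∀ s t : Finset V, s ⊆ t → A (t ∩ V₀) ≤ A (s ∩ V₀) :=
  fun s t hst => hmono (s ∩ V₀) (t ∩ V₀) (Finset.inter_subset_inter hst (Finset.Subset.refl _))

omit [Fintype V] [LinearOrder R] [IsStrictOrderedRing R] in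
/-- **Summing out one virtual coordinate.** For `r ∈ ent ⊆ U`, a virtual vertex `r' ∉ V₀ ⊇ U ∪ X`,
the coin `c` injective at `r` on `ent`, and a marker function `J` blind to `r'`: the extended
sure-coin mixed value (entry set `insert r' (ent.erase r)`, the coin of `r` made sure, the coin
map sending `r'` to `c r`, the head `A (· ∩ V₀)`) integrated against the extended law returns
the original mixed value integrated against `ν`. -/
theorem ext_sum_one (U : Finset V) (ν A : Finset V → R) (pr : E → R) (ent : Finset V) (c : V → E)
    (r r' : V) (X V₀ : Finset V) (J : Finset V → R)
    (hrent : r ∈ ent) (hentU : ent ⊆ U) (hUV : U ⊆ V₀) (hXV : X ⊆ V₀) (hr'V : r' ∉ V₀)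
    (hcinj : ∀ q ∈ ent, c q = c r → q = r) (hJ : ∀ W ⊆ U, J (insert r' W) = J W) :
    (∑ W' ∈ (insert r' U).powerset,
        (ν (W' ∩ U) * (if r' ∈ W' then (if r ∈ W' then pr (c r) else 0)
            else (if r ∈ W' then 1 - pr (c r) else 1))) *
          (tailWtK (fun e => if e = c r then (1 : R) else pr e) (insert r' (ent.erase r))
              (fun v => if v = r' then c r else c v) W' * A (W' ∩ V₀) +
            (1 - tailWtK (fun e => if e = c r then (1 : R) else pr e) (insert r' (ent.erase r))
              (fun v => if v = r' then c r else c v) W') * A ((W' ∪ X) ∩ V₀)) * J W') =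
      ∑ W ∈ U.powerset,
        ν W * (tailWtK pr ent c W * A W + (1 - tailWtK pr ent c W) * A (W ∪ X)) * J W := by
  have hr'U : r' ∉ U := fun h => hr'V (hUV h)
  rw [Finset.sum_powerset_insert hr'U, ← Finset.sum_add_distrib]
  refine Finset.sum_congr rfl fun W hW => ?_
  rw [Finset.mem_powerset] at hW
  have hr'W : r' ∉ W := fun h => hr'U (hW h)
  have hrr' : r ≠ r' := fun h => hr'U (h ▸ hentU hrent)
  have hWU : W ∩ U = W := Finset.inter_eq_left.mpr hW
  have hiWU : insert r' W ∩ U = W := by rw [Finset.insert_inter_of_notMem hr'U, hWU]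
  obtain ⟨hcf1, hcf2⟩ := coinFactor_split r r' (pr (c r)) hr'W hrr'
  have hr'er : r' ∉ ent.erase r := fun h => hr'U (hentU (Finset.mem_of_mem_erase h))
  -- the extended tail weight on `W`: the tail weight of the other entries
  have htw : tailWtK (fun e => if e = c r then (1 : R) else pr e) (insert r' (ent.erase r))
      (fun v => if v = r' then c r else c v) W = tailWtK pr (ent.erase r) c W := by
    unfold tailWtK
    rw [Finset.prod_insert hr'er]
    have h1 : (1 - (if (if r' = r' then c r else c r') = c r then (1 : R) else pr (if r' = r' then c r else c r')) *
        (if r' ∈ W then (1 : R) else 0)) = 1 := by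
      rw [if_neg hr'W]; ring
    rw [h1, one_mul]
    refine Finset.prod_congr rfl fun q hq => ?_
    beta_reduce
    have hq' : q ∈ ent := Finset.mem_of_mem_erase hq
    have hqr : q ≠ r := Finset.ne_of_mem_erase hq
    have hqr' : q ≠ r' := fun h => hr'U (h ▸ hentU hq')
    have hc' : (if q = r' then c r else c q) = c q := if_neg hqr'
    have hcq : c q ≠ c r := fun h => hqr (hcinj q hq' h)
    rw [hc', if_neg hcq]
  -- the extended tail weight on `insert r' W`: zero (the virtual entry is present and sure)
  have htw' : tailWtK (fun e => if e = c r then (1 : R) else pr e) (insert r' (ent.erase r))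
      (fun v => if v = r' then c r else c v) (insert r' W) = 0 := by
    unfold tailWtK
    rw [Finset.prod_insert hr'er]
    have h1 : (1 - (if (if r' = r' then c r else c r') = c r then (1 : R) else pr (if r' = r' then c r else c r')) *
        (if r' ∈ insert r' W then (1 : R) else 0)) = 0 := by
      rw [if_pos (Finset.mem_insert_self r' W), if_pos rfl, if_pos rfl]; ring
    rw [h1, zero_mul]
  -- the extended head values
  have hWV : W ⊆ V₀ := hW.trans hUV
  have hA1 : A (W ∩ V₀) = A W := by rw [Finset.inter_eq_left.mpr hWV]
  have hA2 : A ((W ∪ X) ∩ V₀) = A (W ∪ X) := by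
    rw [Finset.inter_eq_left.mpr (Finset.union_subset hWV hXV)]
  have hA3 : A ((insert r' W ∪ X) ∩ V₀) = A (W ∪ X) := by
    rw [Finset.insert_union, Finset.insert_inter_of_notMem hr'V,
      Finset.inter_eq_left.mpr (Finset.union_subset hWV hXV)]
  have hJ' := hJ W hW
  have hte := tailWtK_erase pr c hrent W
  rw [hWU, hiWU, hcf1, hcf2, htw, htw', hA1, hA2, hA3, hJ', hte]
  ring

end OneCoin

end Summit.Ventures.PercRepro2.Coin
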